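import Literature.InformationTheory.QuantumCodes.ToricCodeDistance
import HarnessLib

/-!
# Lattice self-duality of the toric code: the `X`-sector decoding problem IS the `Z`-sector problem
# (stars ↔ plaquettes under `(v, i) ↦ (-v, 1-i)`), so every `Z`-sector threshold holds for `X`-errors

Topic `Literature/InformationTheory/QuantumCodes` (venture QEC, LADDER-QEC rung Q5, PARTITION row 09; qec-type-09
gen 3). PROVED, kernel axioms, no named fact. The square lattice on the torus is self-dual: the tree's duality
`ToricCode.dualEdge L : Edge L ≃ Edge L`, `(v, i) ↦ (-v, rev i)` (qec-type-08, `ToricCodeDistance.lean`, with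
`plaquetteMatrix_eq_submatrix : H^Z = H^X.submatrix neg dualEdge`, used there for `d^X = d^Z = L` and the optimal
bit-flip radius) is taken here to the PROBABILISTIC statements. Consequences for the toric code `toricCode L`
(`ToricCodeThreshold.lean`; `H^X = starMatrix`, `H^Z = plaquetteMatrix`) and the pull-back `dualChain x = x ∘ dualEdge`:

* `plaquetteMatrix_mulVec` — `H^Z x = (H^X (dualChain x)) ∘ neg`: the `Z`-syndrome of a bit-flip pattern is the
  `X`-syndrome of its dual pattern, read at the antipodal sites;
* (the duality `dualEdge`, `plaquetteMatrix_eq_submatrix`: imported) `dualChain_mem_boundaries_iff` — `x ∈ rs H^X ↔ dualChain x ∈ rs H^Z` (trivial `X`-errors ↔ trivial `Z`-errors);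
* `hammingNorm_dualChain` — weights are preserved;
* `dualDecoder DX` — the `Z`-decoder conjugate to an `X`-decoder `DX` (`σ ↦ dualChain (DX (σ ∘ neg))`);
  `isMinWeight_dualDecoder`: `DX` minimum-weight for the `X`-sector ⇒ `dualDecoder DX` minimum-weight for the
  `Z`-sector (`syn`, `cycles`);
* `xFailureProb_eq_failureProb_dualDecoder` — the `X`-sector failure probability of `DX` under independent bit
  flips of rate `p` EQUALS the tree's `failureProb L (dualDecoder DX) p` (the `Z`-sector object of every toric
  threshold theorem in the tree): so every certified `Z`-sector threshold of the toric code (`p₀(3)`, `p₀(2.832)`,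
  the native / PT2000 tiers) is at once a certified `X`-sector threshold — packaged Summits-side
  (`Thresholds/ToricCodeXSectorThresholds.lean`), together with the depolarizing threshold `(3/2)·p₀`.

## References

* [DennisEtAl2002] E. Dennis, A. Kitaev, A. Landahl, J. Preskill, J. Math. Phys. 43 (2002) 4452, §3.1 (the dual
  lattice: "X errors … are strings on the dual lattice"; stars and plaquettes exchanged), §4.1 (X and Z errors
  treated separately and identically).
-/

noncomputable section

namespace Literature.InformationTheory.QuantumCodes

namespace ToricCode

open Finset Matrix

variable {L : ℕ}

/-! ### The duality map (from `ToricCodeDistance.lean`) -/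

/-- The duality map is an involution. [cite: DennisEtAl2002, §3.1 (the dual of the dual lattice is the lattice)] -/
@[simp] theorem dualEdge_apply_dualEdge (ℓ : Edge L) : dualEdge L (dualEdge L ℓ) = ℓ := by
  obtain ⟨v, i⟩ := ℓ
  simp [dualEdge, Fin.rev_rev]

/-- Entry form of the tree's `plaquetteMatrix_eq_submatrix`: `H^Z_{w,ℓ} = H^X_{-w, dualEdge ℓ}`.
[cite: DennisEtAl2002, §3.1 (self-duality of the square lattice)] -/
theorem plaquetteMatrix_apply_eq [NeZero L] (w : Vertex L) (ℓ : Edge L) :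
    plaquetteMatrix L w ℓ = starMatrix L (-w) (dualEdge L ℓ) := by
  rw [plaquetteMatrix_eq_submatrix]
  rfl

/-! ### The pull-back of chains -/

/-- The dual of a chain: `x ∘ dualEdge` (an `X`-error pattern read as a `Z`-error pattern on the dual picture).
[cite: DennisEtAl2002, §3.1 (X errors are strings on the dual lattice)] -/
def dualChain (x : Chain L) : Chain L := fun ℓ => x (dualEdge L ℓ)

/-- The pull-back is an involution. [cite: DennisEtAl2002, §3.1] -/
@[simp] theorem dualChain_dualChain (x : Chain L) : dualChain (dualChain x) = x := by
  funext ℓ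
  simp [dualChain]

/-- The pull-back is additive. [cite: DennisEtAl2002, §3.1 (the duality is a linear identification of chains)] -/
theorem dualChain_add (x y : Chain L) : dualChain (x + y) = dualChain x + dualChain y := rfl

/-- **Weights are preserved**: `|dualChain x| = |x|`. [cite: DennisEtAl2002, §3.1 (duality is a bijection of links)] -/
theorem hammingNorm_dualChain [NeZero L] (x : Chain L) : hammingNorm (dualChain x) = hammingNorm x := by
  unfold hammingNorm dualChain
  exact Finset.card_equiv (dualEdge L) fun ℓ => by simp

/-- The support of the dual chain is the image of the support. [cite: DennisEtAl2002, §3.1] -/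
theorem card_supp_dualChain [NeZero L] (x : Chain L) : (supp (dualChain x)).card = (supp x).card := by
  have h := hammingNorm_dualChain x
  unfold hammingNorm at h
  simpa [supp] using h

/-- **`H^Z x = (H^X x^*) ∘ neg`**: the `Z`-check syndrome of the bit-flip pattern `x` at the plaquette `w` is the
`X`-check syndrome of the dual pattern at the site `-w`. [cite: DennisEtAl2002, §3.1 and §4.1 (X errors detected at plaquettes = sites of the dual lattice)] -/
theorem plaquetteMatrix_mulVec [NeZero L] (x : Chain L) (w : Vertex L) :
    (plaquetteMatrix L *ᵥ x) w = (starMatrix L *ᵥ dualChain x) (-w) := by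
  simp only [mulVec, dotProduct]
  rw [← Equiv.sum_comp (dualEdge L)]
  refine Finset.sum_congr rfl fun ℓ _ => ?_
  simp only [dualChain, plaquetteMatrix_apply_eq, dualEdge_apply_dualEdge]

/-- Row spaces: the dual of a sum of plaquette boundaries is a sum of stars, `dualChain (rs H^Z) ⊆ rs H^X`.
[cite: DennisEtAl2002, §3.1 (self-duality)] -/
theorem dualChain_mem_rowSpX_of_mem_boundaries [NeZero L] {x : Chain L}
    (hx : x ∈ rowSpace (plaquetteMatrix L)) : dualChain x ∈ rowSpace (starMatrix L) := by
  rw [mem_rowSpace_iff] at hx ⊢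
  obtain ⟨y, rfl⟩ := hx
  refine ⟨fun s => y (-s), ?_⟩
  funext ℓ
  simp only [vecMul, dotProduct, dualChain]
  exact Fintype.sum_equiv (Equiv.neg (Vertex L)) _ _ fun s => by
    simp only [Equiv.neg_apply, plaquetteMatrix_apply_eq, neg_neg, dualEdge_apply_dualEdge]

/-- Conversely `dualChain (rs H^X) ⊆ rs H^Z`. [cite: DennisEtAl2002, §3.1 (self-duality)] -/
theorem dualChain_mem_boundaries_of_mem_rowSpX [NeZero L] {x : Chain L}
    (hx : x ∈ rowSpace (starMatrix L)) : dualChain x ∈ rowSpace (plaquetteMatrix L) := by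
  rw [mem_rowSpace_iff] at hx ⊢
  obtain ⟨y, rfl⟩ := hx
  refine ⟨fun w => y (-w), ?_⟩
  funext ℓ
  simp only [vecMul, dotProduct, dualChain]
  exact Fintype.sum_equiv (Equiv.neg (Vertex L)) _ _ fun w => by
    simp only [Equiv.neg_apply, plaquetteMatrix_apply_eq]

/-- **Trivial `X`-errors ↔ trivial `Z`-errors**: `x ∈ rs H^X ↔ dualChain x ∈ rs H^Z`.
[cite: DennisEtAl2002, §3.1 and §4.3 (homologically trivial on the lattice ↔ on the dual lattice)] -/
theorem dualChain_mem_boundaries_iff [NeZero L] (x : Chain L) :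
    dualChain x ∈ boundaries L ↔ x ∈ (rowSpace (starMatrix L) : Set (Chain L)) := by
  constructor
  · intro h
    have := dualChain_mem_rowSpX_of_mem_boundaries (L := L) h
    rwa [dualChain_dualChain] at this
  · exact fun h => dualChain_mem_boundaries_of_mem_rowSpX h

/-! ### Conjugating decoders -/

/-- **The `Z`-decoder conjugate to an `X`-decoder** `DX` (syndromes on plaquettes ↦ bit-flip corrections): read a
star syndrome `σ` at the antipodal sites as a plaquette syndrome, decode, dualise the correction.
[cite: DennisEtAl2002, §4.1 (X errors are decoded exactly as Z errors, on the dual lattice)] -/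
def dualDecoder (DX : Decoder (Vertex L → ZMod 2) (Chain L)) : ZDecoder L :=
  fun σ => dualChain (DX (fun w => σ (-w)))

/-- The conjugate decoder on the syndrome of a dual chain: `dualDecoder DX (∂ x^*) = (DX (H^Z x))^*`.
[cite: DennisEtAl2002, §4.1] -/
theorem dualDecoder_syn [NeZero L] (DX : Decoder (Vertex L → ZMod 2) (Chain L)) (x : Chain L) :
    dualDecoder DX (syn L (dualChain x)) = dualChain (DX (plaquetteMatrix L *ᵥ x)) := by
  have h : (fun w => syn L (dualChain x) (-w)) = plaquetteMatrix L *ᵥ x := by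
    funext w
    rw [plaquetteMatrix_mulVec]
    rfl
  simp only [dualDecoder, h]

/-- **Minimum weight is preserved by conjugation**: if `DX` is a minimum-weight decoder of the `Z`-check
syndrome (w.r.t. `ker H^Z`), then `dualDecoder DX` is a minimum-weight decoder of the star syndrome w.r.t. the
cycles. [cite: DennisEtAl2002, §5.1 (E_min on the lattice and on the dual lattice)] -/
theorem isMinWeight_dualDecoder [NeZero L] {DX : Decoder (Vertex L → ZMod 2) (Chain L)}
    (hDX : DX.IsMinWeight (toricCode L).xSyndrome ((toricCode L).kerZ : Set (Chain L)) hammingNorm) :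
    (dualDecoder DX).IsMinWeight (syn L) (cycles L) hammingNorm := by
  -- the two clauses of `hDX`, with `H^Z = plaquetteMatrix` made explicit
  have h1 : ∀ x : Chain L, plaquetteMatrix L *ᵥ (DX (plaquetteMatrix L *ᵥ x) + x) = 0 := fun x =>
    ((toricCode L).mem_kerZ_iff _).1 (SetLike.mem_coe.1 (hDX.add_mem x))
  have h2 : ∀ x : Chain L, hammingNorm (DX (plaquetteMatrix L *ᵥ x)) ≤ hammingNorm x := fun x =>
    hDX.weight_le x
  have hsyn : ∀ e : Chain L,
      dualDecoder DX (syn L e) = dualChain (DX (plaquetteMatrix L *ᵥ dualChain e)) := by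
    intro e
    have := dualDecoder_syn DX (dualChain e)
    rwa [dualChain_dualChain] at this
  refine ⟨fun e => ?_, fun e => ?_⟩
  · have hgoal : dualDecoder DX (syn L e) + e =
        dualChain (DX (plaquetteMatrix L *ᵥ dualChain e) + dualChain e) := by
      rw [hsyn, dualChain_add, dualChain_dualChain]
    rw [hgoal]
    simp only [cycles, Set.mem_setOf_eq, syn]
    funext s
    have := congrFun (h1 (dualChain e)) (-s)
    rw [plaquetteMatrix_mulVec, neg_neg] at this
    exact this
  · rw [hsyn, hammingNorm_dualChain]
    have := h2 (dualChain e)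
    rwa [hammingNorm_dualChain] at this

/-- **Failure events correspond**: `DX` fails on the bit-flip pattern `x` (residual `∉ rs H^X`) iff
`dualDecoder DX` fails on the phase-flip pattern `dualChain x` (residual not a boundary).
[cite: DennisEtAl2002, §4.3 (success iff the residual is homologically trivial, on either lattice)] -/
theorem not_corrects_dual_iff [NeZero L] (DX : Decoder (Vertex L → ZMod 2) (Chain L)) (x : Chain L) :
    ¬ (dualDecoder DX).Corrects (syn L) (boundaries L) (dualChain x) ↔
      ¬ DX.Corrects (toricCode L).xSyndrome ((toricCode L).rowSpX : Set (Chain L)) x := by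
  rw [not_iff_not, Decoder.corrects_iff, Decoder.corrects_iff, dualDecoder_syn, ← dualChain_add,
    dualChain_mem_boundaries_iff]
  rfl

open Classical in
/-- **The `X`-sector failure probability is a `Z`-sector failure probability**: under independent bit flips of
rate `p`, the probability that `DX` leaves an `X`-logical error on the `L × L` toric code equals
`failureProb L (dualDecoder DX) p` — the object of every `Z`-sector threshold theorem of the tree.
[cite: DennisEtAl2002, §4.1 ("we may treat X errors and Z errors separately" — and identically, by duality)] -/
theorem xFailureProb_eq_failureProb_dualDecoder [NeZero L] (DX : Decoder (Vertex L → ZMod 2) (Chain L)) (p : ℝ) :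
    ∑ x ∈ univ.filter (fun x : Chain L =>
        ¬ DX.Corrects (toricCode L).xSyndrome ((toricCode L).rowSpX : Set (Chain L)) x),
        bernoulliWeight p (supp x) =
      failureProb L (dualDecoder DX) p := by
  unfold failureProb
  -- reindex the failure sum of `dualDecoder DX` by the involution `dualChain`
  have hbij : ∀ x : Chain L, bernoulliWeight p (supp (dualChain x)) = bernoulliWeight p (supp x) := by
    intro x
    unfold bernoulliWeight
    rw [card_supp_dualChain]
  symm
  refine Finset.sum_bij' (fun e _ => dualChain e) (fun x _ => dualChain x) ?_ ?_ ?_ ?_ ?_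
  · intro e he
    rw [mem_filter] at he ⊢
    refine ⟨mem_univ _, ?_⟩
    rw [← not_corrects_dual_iff, dualChain_dualChain]
    exact he.2
  · intro x hx
    rw [mem_filter] at hx ⊢
    exact ⟨mem_univ _, (not_corrects_dual_iff DX x).2 hx.2⟩
  · intro e _
    exact dualChain_dualChain e
  · intro x _
    exact dualChain_dualChain x
  · intro e _
    rw [← hbij e]

end ToricCode

end Literature.InformationTheory.QuantumCodes
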